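import Mathlib
import Summits.CriticalPhenomena.PercolationContinuityZ3.Theorems.PercNearOneGluingNoHeavyLowerTailStarSetForestCertificateTools
import HarnessLib

/-!
# `NoHeavyLowerTail` (stmt-CriticalPhenomena-4575) — pool accounting in configuration weights (U1-PROOF.md §7 "target scaling"; blueprint F6/B6c)

Support file (prover `prim-gen-swap` gen 13; `--supports stmt-CriticalPhenomena-4575`).  No definitions, no named facts, no sorries.

The POOL of the charging scheme (U1-PROOF.md §7, LEAN-BLUEPRINT-U1.md §F6).  `Pool` is a set of classes (the r-chords and the child edges); the pool
targets are the configurations `R ⊆ Pool`, of total weight `E₀ = Σ_{R ⊆ Pool} W(R) = Π_{V ∉ Pool}(1 − θ_V)`; a residual pair `(X, J)` (two classes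
outside the pool) has its core configurations `{X, J} ⊔ R`, `R ⊆ Pool`, of total weight `θ_Xθ_J·Π_{V ∉ Pool ∪ {X,J}}(1 − θ_V) = E₀·t_Xt_J`
(`t = θ/(1−θ)`).  Hence the memo's scaled pool inequality `Σ_pairs (t_Xt_J − P′·words)⁺ ≤ 1` with `P′ = 1/E₀` is, in absolute terms,
`Σ_pairs (demand − words)⁺ ≤ E₀`, and then the residual core units are paid by their words plus the pool credit:

* `StarSet.pool_credit_eq` — `Σ_S W(S)[S ⊆ Pool] = Π_{V∉Pool}(1−θ_V)`;
* `StarSet.pair_pool_demand_eq` — `Σ_S W(S)[X, J ∈ S, S∖{X,J} ⊆ Pool] = θ_Xθ_J Π_{V ∉ Pool, V ≠ X, J}(1−θ_V)`;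
* `StarSet.pair_pool_demand_eq_scaled` — the same `= E₀ · θ_Xθ_J / ((1−θ_X)(1−θ_J))`;
* `StarSet.prod_one_add_odds_mul_eq_one` — `Π_{V∉Pool}(1 + t_V) · E₀ = 1` (`P′ = 1/E₀`);
* `StarSet.pool_accounting` — `Σ_p demand_p ≤ Σ_p words_p + Σ_p (demand_p − words_p)⁺`.
-/

namespace Summit.CriticalPhenomena.PercolationContinuityZ3.Theorems

open Finset
open scoped BigOperators

namespace StarSet

variable {ι : Type*} [Fintype ι] [DecidableEq ι]

/-- **Pool credit: `Σ_{R ⊆ Pool} W(R) = Π_{V ∉ Pool}(1 − θ_V)`.** -/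
theorem pool_credit_eq (θ : ι → ℝ) (Pool : Finset ι) :
    ∑ S ∈ (univ : Finset ι).powerset, ((∏ k ∈ S, θ k) * ∏ k ∈ univ \ S, (1 - θ k)) * (if S ⊆ Pool then (1 : ℝ) else 0) =
      ∏ k ∈ univ \ Pool, (1 - θ k) := by
  rw [← cylinder_sum_closed θ (univ \ Pool)]
  refine sum_congr rfl fun S _ => ?_
  congr 1
  refine if_congr ?_ rfl rfl
  constructor
  · intro h k hk hkS; exact (mem_sdiff.1 hk).2 (h hkS)
  · intro h k hkS; by_contra hkP; exact h k (mem_sdiff.2 ⟨mem_univ _, hkP⟩) hkS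

/-- **Demand of a residual pair on the pool: `Σ_S W(S)[X, J ∈ S, S ∖ {X,J} ⊆ Pool] = θ_Xθ_J·Π_{V ∉ Pool ∪ {X,J}}(1 − θ_V)`.** -/
theorem pair_pool_demand_eq (θ : ι → ℝ) (Pool : Finset ι) {X J : ι} (hXJ : X ≠ J) :
    ∑ S ∈ (univ : Finset ι).powerset, ((∏ k ∈ S, θ k) * ∏ k ∈ univ \ S, (1 - θ k)) *
        (if (X ∈ S ∧ J ∈ S ∧ S \ {X, J} ⊆ Pool) then (1 : ℝ) else 0) =
      θ X * θ J * ∏ k ∈ univ \ (Pool ∪ {X, J}), (1 - θ k) := by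
  have hdisj : Disjoint ({X, J} : Finset ι) (univ \ (Pool ∪ {X, J})) := by
    rw [disjoint_left]
    intro k hk hk'
    exact (mem_sdiff.1 hk').2 (mem_union_right _ hk)
  rw [← prod_pair hXJ, ← cylinder_sum θ {X, J} (univ \ (Pool ∪ {X, J})) hdisj]
  refine sum_congr rfl fun S _ => ?_
  congr 1
  refine if_congr ?_ rfl rfl
  constructor
  · rintro ⟨hXS, hJS, hsub⟩
    refine ⟨?_, fun k hk hkS => ?_⟩
    · intro k hk
      rcases mem_insert.1 hk with rfl | hk
      · exact hXS
      · rw [mem_singleton.1 hk]; exact hJS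
    · have hk' := mem_sdiff.1 hk
      rw [mem_union, not_or] at hk'
      exact hk'.2.1 (hsub (mem_sdiff.2 ⟨hkS, hk'.2.2⟩))
  · rintro ⟨hsub, hout⟩
    refine ⟨hsub (mem_insert_self X _), hsub (mem_insert_of_mem (mem_singleton_self J)), fun k hk => ?_⟩
    obtain ⟨hkS, hkXJ⟩ := mem_sdiff.1 hk
    by_contra hkP
    exact hout k (mem_sdiff.2 ⟨mem_univ _, by rw [mem_union, not_or]; exact ⟨hkP, hkXJ⟩⟩) hkS

/-- The pair demand in pool units: `θ_Xθ_J·Π_{V ∉ Pool ∪ {X,J}}(1 − θ_V) = E₀·θ_Xθ_J/((1−θ_X)(1−θ_J))` when `θ_X, θ_J < 1`. -/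
theorem pair_pool_demand_eq_scaled (θ : ι → ℝ) (Pool : Finset ι) {X J : ι} (hXJ : X ≠ J) (hX : X ∉ Pool) (hJ : J ∉ Pool)
    (hθX : θ X < 1) (hθJ : θ J < 1) :
    θ X * θ J * ∏ k ∈ univ \ (Pool ∪ {X, J}), (1 - θ k) =
      (∏ k ∈ univ \ Pool, (1 - θ k)) * (θ X * θ J / ((1 - θ X) * (1 - θ J))) := by
  have hsplit : univ \ Pool = (univ \ (Pool ∪ {X, J})) ∪ {X, J} := by
    ext k
    simp only [mem_sdiff, mem_univ, true_and, mem_union, mem_insert, mem_singleton, not_or]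
    constructor
    · intro hk
      by_cases h1 : k = X
      · exact Or.inr (Or.inl h1)
      · by_cases h2 : k = J
        · exact Or.inr (Or.inr h2)
        · exact Or.inl ⟨hk, h1, h2⟩
    · rintro (⟨hk, -, -⟩ | rfl | rfl)
      · exact hk
      · exact hX
      · exact hJ
  have hdisj : Disjoint (univ \ (Pool ∪ {X, J})) ({X, J} : Finset ι) := by
    rw [disjoint_right]
    intro k hk hk'
    exact (mem_sdiff.1 hk').2 (mem_union_right _ hk)
  rw [hsplit, prod_union hdisj, prod_pair hXJ]
  have h1 : 1 - θ X ≠ 0 := by linarith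
  have h2 : 1 - θ J ≠ 0 := by linarith
  field_simp

/-- **`P′·E₀ = 1`**: `Π_{V∉Pool}(1 + θ_V/(1−θ_V)) · Π_{V∉Pool}(1 − θ_V) = 1` when all `θ_V < 1`. -/
theorem prod_one_add_odds_mul_eq_one (θ : ι → ℝ) (Pool : Finset ι) (hθ1 : ∀ k, θ k < 1) :
    (∏ k ∈ univ \ Pool, (1 + θ k / (1 - θ k))) * ∏ k ∈ univ \ Pool, (1 - θ k) = 1 := by
  rw [← prod_mul_distrib]
  refine prod_eq_one fun k _ => ?_
  have h : 1 - θ k ≠ 0 := by linarith [hθ1 k]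
  field_simp
  ring

/-- **Pool accounting**: `Σ_p d_p ≤ Σ_p c_p + Σ_p (d_p − c_p)⁺`. -/
theorem pool_accounting {π : Type*} (Ps : Finset π) (d c : π → ℝ) :
    ∑ p ∈ Ps, d p ≤ ∑ p ∈ Ps, c p + ∑ p ∈ Ps, max 0 (d p - c p) := by
  rw [← sum_add_distrib]
  exact sum_le_sum fun p _ => by
    rcases le_total (d p) (c p) with h | h
    · rw [max_eq_left (by linarith)]; linarith
    · rw [max_eq_right (by linarith)]; linarith

end StarSet

end Summit.CriticalPhenomena.PercolationContinuityZ3.Theorems
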